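import Mathlib
import Literature.Analysis.Complex.ArgumentPrincipleRectangle

/-!
# `MatrixDescartes` — kit for the LETTER-SEPARATED SECTOR, I: Leibniz perturbation of determinants and
# Rouché's theorem on a rectangle

HONEST FRAMING.  Object-search cell `pub-symmetroid`, crux `Theses.LacunarySymmetroid.MatrixDescartes`
(ledger item `stmt-ValiantsHypothesis-18050`, route `LacunarySymmetroid`; seat `val-sym-mdr-p2`, gen 12).  The
crux implies `VP ≠ VNP` by the route's assembly; NOTHING here is progress on it and nothing here is a claim
about `VP ≠ VNP`, `DoorA26` / `DoorA34` or the cell's registers.  Generic analysis for the structural form of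
the two-letter window law (`…RoucheWindow.lean`): there the certificate is one circle inequality; the
structural law replaces the circle by a RECTANGLE in the logarithmic variable `t = log x` (vertical sides deep
in single-letter dominance, horizontal sides at an argument avoiding the root arguments of the two-letter
characteristic polynomial), which needs Rouché's theorem for rectangles and an explicit perturbation bound
for determinants.

* §1 **Leibniz perturbation bound** (`norm_det_add_sub_det_le`, `norm_det_add_sub_det_le'`): for complex
  `m × m` matrices with entries `‖M i j‖ ≤ μ`, `‖E i j‖ ≤ ε`:
  `‖det (M + E) − det M‖ ≤ m!·((μ+ε)^m − μ^m) ≤ m!·m·ε·(μ+ε)^(m−1)` (expand each of the `m!` Leibniz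
  products; `norm_prod_add_sub_prod_le`, `pow_sub_pow_le`).
* §2 **Rouché on a rectangle** (`finsum_order_eq_of_norm_sub_lt_rect`): for `Φ, Ψ` analytic on a
  neighbourhood of every point of `[a,b] × [c,d]` with `‖Φ − Ψ‖ < ‖Ψ‖` on the boundary, the zeros of `Φ`
  and `Ψ` in the open rectangle counted with multiplicity (the `ℂ`-valued `∑ᶠ (meromorphicOrderAt · ρ).untop₀`
  of the tree's argument principle `Literature.Analysis.Complex.integral_boundary_rect_logDeriv`) coincide:
  `Φ'/Φ = Ψ'/Ψ + h'/h` on the boundary with `h = Φ/Ψ` (`logDeriv_split`) and `h` takes boundary values in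
  the disc `|h − 1| < 1`, inside the slit plane, so its change of argument vanishes
  (`Literature.Analysis.Complex.integral_boundary_rect_logDeriv_eq_zero_of_mem_slitPlane`).

[cite: Conway1978, Ch. V §3 Thm 3.4 (argument principle), Thm 3.8 (Rouché)]; the Leibniz bound is folklore.
-/

-- `Summit.ValiantsHypothesis.ValiantsHypothesis.…` repeats a component by the D-0017 layout
-- (single-conjunct summit), which the `dupNamespace` linter flags; the name is mandated.
set_option linter.dupNamespace false

namespace Summit.ValiantsHypothesis.ValiantsHypothesis.Theorems.LacunarySymmetroidMatrixDescartes.Separated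

open Polynomial Complex Set Finset
open scoped BigOperators Matrix Real

/-! ## §1 Leibniz perturbation bound for determinants -/

/-- Products: if `‖a i‖ ≤ μ` and `‖e i‖ ≤ ε` then `‖∏ (a i + e i) − ∏ a i‖ ≤ (μ+ε)^n − μ^n` over any finset of
indices of size `n`. [folklore] -/
theorem norm_prod_add_sub_prod_le {ι : Type*} [DecidableEq ι] (s : Finset ι) (a e : ι → ℂ) {μ ε : ℝ}
    (hμ : 0 ≤ μ) (hε : 0 ≤ ε) (ha : ∀ i ∈ s, ‖a i‖ ≤ μ) (he : ∀ i ∈ s, ‖e i‖ ≤ ε) :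
    ‖∏ i ∈ s, (a i + e i) - ∏ i ∈ s, a i‖ ≤ (μ + ε) ^ s.card - μ ^ s.card := by
  induction s using Finset.induction_on with
  | empty => simp
  | insert j s hj ih =>
    have ha' : ∀ i ∈ s, ‖a i‖ ≤ μ := fun i hi => ha i (mem_insert_of_mem hi)
    have he' : ∀ i ∈ s, ‖e i‖ ≤ ε := fun i hi => he i (mem_insert_of_mem hi)
    have ih' := ih ha' he'
    rw [prod_insert hj, prod_insert hj, card_insert_of_notMem hj]
    have hsplit : (a j + e j) * ∏ i ∈ s, (a i + e i) - a j * ∏ i ∈ s, a i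
        = (a j + e j) * (∏ i ∈ s, (a i + e i) - ∏ i ∈ s, a i) + e j * ∏ i ∈ s, a i := by ring
    rw [hsplit]
    have h1 : ‖a j + e j‖ ≤ μ + ε := (norm_add_le _ _).trans (add_le_add (ha j (mem_insert_self _ _))
      (he j (mem_insert_self _ _)))
    have h2 : ‖∏ i ∈ s, a i‖ ≤ μ ^ s.card := by
      rw [norm_prod]
      calc ∏ i ∈ s, ‖a i‖ ≤ ∏ _i ∈ s, μ := prod_le_prod (fun i _ => norm_nonneg _) ha'
        _ = μ ^ s.card := prod_const μ
    have hpow : μ ^ s.card ≤ (μ + ε) ^ s.card := pow_le_pow_left₀ hμ (by linarith) _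
    calc ‖(a j + e j) * (∏ i ∈ s, (a i + e i) - ∏ i ∈ s, a i) + e j * ∏ i ∈ s, a i‖
        ≤ ‖a j + e j‖ * ‖∏ i ∈ s, (a i + e i) - ∏ i ∈ s, a i‖ + ‖e j‖ * ‖∏ i ∈ s, a i‖ := by
          refine (norm_add_le _ _).trans ?_
          rw [norm_mul, norm_mul]
      _ ≤ (μ + ε) * ((μ + ε) ^ s.card - μ ^ s.card) + ε * μ ^ s.card := by
          have hd : 0 ≤ (μ + ε) ^ s.card - μ ^ s.card := by linarith
          have h3 : ‖e j‖ ≤ ε := he j (mem_insert_self _ _)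
          have h4 := mul_le_mul h1 ih' (norm_nonneg _) (by linarith)
          have h5 := mul_le_mul h3 h2 (norm_nonneg _) hε
          linarith
      _ = (μ + ε) ^ (s.card + 1) - μ ^ (s.card + 1) := by ring

/-- **Leibniz perturbation bound.**  For complex `m × m` matrices with `‖M i j‖ ≤ μ` and `‖E i j‖ ≤ ε`:
`‖det (M + E) − det M‖ ≤ m! · ((μ+ε)^m − μ^m)`. [folklore] -/
theorem norm_det_add_sub_det_le {m : ℕ} (M E : Matrix (Fin m) (Fin m) ℂ) {μ ε : ℝ} (hμ : 0 ≤ μ)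
    (hε : 0 ≤ ε) (hM : ∀ i j, ‖M i j‖ ≤ μ) (hE : ∀ i j, ‖E i j‖ ≤ ε) :
    ‖(M + E).det - M.det‖ ≤ m.factorial * ((μ + ε) ^ m - μ ^ m) := by
  rw [Matrix.det_apply, Matrix.det_apply, ← sum_sub_distrib]
  calc ‖∑ σ : Equiv.Perm (Fin m), (Equiv.Perm.sign σ • ∏ i, (M + E) (σ i) i -
          Equiv.Perm.sign σ • ∏ i, M (σ i) i)‖
      ≤ ∑ σ : Equiv.Perm (Fin m), ‖Equiv.Perm.sign σ • ∏ i, (M + E) (σ i) i -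
          Equiv.Perm.sign σ • ∏ i, M (σ i) i‖ := norm_sum_le _ _
    _ ≤ ∑ _σ : Equiv.Perm (Fin m), ((μ + ε) ^ m - μ ^ m) := by
        refine sum_le_sum fun σ _ => ?_
        have hprod : ‖∏ i, (M + E) (σ i) i - ∏ i, M (σ i) i‖ ≤ (μ + ε) ^ m - μ ^ m := by
          have h := norm_prod_add_sub_prod_le (Finset.univ : Finset (Fin m)) (fun i => M (σ i) i)
            (fun i => E (σ i) i) hμ hε (fun i _ => hM _ _) (fun i _ => hE _ _)
          simpa only [Matrix.add_apply, card_univ, Fintype.card_fin] using h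
        rw [← smul_sub]
        rcases Int.units_eq_one_or (Equiv.Perm.sign σ) with h | h
        · rw [h, one_smul]; exact hprod
        · rw [h, Units.smul_def, Units.val_neg, Units.val_one, neg_smul, one_smul, norm_neg]; exact hprod
    _ = m.factorial * ((μ + ε) ^ m - μ ^ m) := by
        rw [sum_const, card_univ, Fintype.card_perm, Fintype.card_fin, nsmul_eq_mul]


/-- `(μ+ε)^m − μ^m ≤ m·ε·(μ+ε)^(m−1)` for `μ, ε ≥ 0`. [folklore] -/
theorem pow_sub_pow_le (μ ε : ℝ) (hμ : 0 ≤ μ) (hε : 0 ≤ ε) (m : ℕ) :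
    (μ + ε) ^ m - μ ^ m ≤ m * ε * (μ + ε) ^ (m - 1) := by
  have key := (Commute.all (μ + ε) μ).geom_sum₂_mul m
  rw [add_sub_cancel_left] at key
  rw [← key]
  have hterm : ∀ i ∈ range m, (μ + ε) ^ i * μ ^ (m - 1 - i) ≤ (μ + ε) ^ (m - 1) := by
    intro i hi
    rw [Finset.mem_range] at hi
    calc (μ + ε) ^ i * μ ^ (m - 1 - i) ≤ (μ + ε) ^ i * (μ + ε) ^ (m - 1 - i) :=
          mul_le_mul_of_nonneg_left (pow_le_pow_left₀ hμ (by linarith) _) (pow_nonneg (by linarith) _)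
      _ = (μ + ε) ^ (m - 1) := by rw [← pow_add]; congr 1; omega
  calc (∑ i ∈ range m, (μ + ε) ^ i * μ ^ (m - 1 - i)) * ε
      ≤ (∑ _i ∈ range m, (μ + ε) ^ (m - 1)) * ε := mul_le_mul_of_nonneg_right (sum_le_sum hterm) hε
    _ = m * ε * (μ + ε) ^ (m - 1) := by rw [sum_const, card_range, nsmul_eq_mul]; ring

/-- **Leibniz perturbation bound, linearised**: `‖det (M + E) − det M‖ ≤ m!·m·ε·(μ+ε)^(m−1)`. [folklore] -/
theorem norm_det_add_sub_det_le' {m : ℕ} (M E : Matrix (Fin m) (Fin m) ℂ) {μ ε : ℝ} (hμ : 0 ≤ μ)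
    (hε : 0 ≤ ε) (hM : ∀ i j, ‖M i j‖ ≤ μ) (hE : ∀ i j, ‖E i j‖ ≤ ε) :
    ‖(M + E).det - M.det‖ ≤ m.factorial * (m * ε * (μ + ε) ^ (m - 1)) :=
  (norm_det_add_sub_det_le M E hμ hε hM hE).trans
    (mul_le_mul_of_nonneg_left (pow_sub_pow_le μ ε hμ hε m) (Nat.cast_nonneg _))

/-! ## §2 Rouché's theorem on a rectangle (from the tree's argument principle) -/

section Rouche

variable {a b c d : ℝ}

/-- If `‖Φ z − Ψ z‖ < ‖Ψ z‖` then `Ψ z ≠ 0`, `Φ z ≠ 0` and `Φ z / Ψ z` lies in the slit plane. [folklore] -/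
theorem aux_of_norm_sub_lt {Φz Ψz : ℂ} (h : ‖Φz - Ψz‖ < ‖Ψz‖) :
    Ψz ≠ 0 ∧ Φz ≠ 0 ∧ Φz / Ψz ∈ slitPlane := by
  have hΨ : Ψz ≠ 0 := fun h0 => by rw [h0, sub_zero, norm_zero] at h; exact (norm_nonneg _).not_gt h
  have hΦ : Φz ≠ 0 := fun h0 => by rw [h0, zero_sub, norm_neg] at h; exact lt_irrefl _ h
  refine ⟨hΨ, hΦ, ?_⟩
  rw [mem_slitPlane_iff]
  left
  have h1 : ‖Φz / Ψz - 1‖ < 1 := by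
    rw [div_sub_one hΨ, norm_div, div_lt_one (norm_pos_iff.2 hΨ)]
    exact h
  have h2 : |(Φz / Ψz - 1).re| < 1 := (abs_re_le_norm _).trans_lt h1
  rw [sub_re, one_re] at h2
  have := (abs_lt.1 h2).1
  linarith

/-- Logarithmic derivative of a quotient at a point where the denominator is nonzero:
`Φ'/Φ = Ψ'/Ψ + (Φ/Ψ)'/(Φ/Ψ)`. [folklore] -/
theorem logDeriv_split {Φ Ψ : ℂ → ℂ} {z : ℂ} (hΦ : AnalyticAt ℂ Φ z) (hΨ : AnalyticAt ℂ Ψ z)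
    (hΨz : Ψ z ≠ 0) (hΦz : Φ z ≠ 0) :
    deriv Φ z / Φ z = deriv Ψ z / Ψ z +
      deriv (fun w => Φ w / Ψ w) z / ((fun w => Φ w / Ψ w) z) := by
  have hev : Φ =ᶠ[nhds z] fun w => Ψ w * (Φ w / Ψ w) := by
    have hne : ∀ᶠ w in nhds z, Ψ w ≠ 0 := hΨ.continuousAt.eventually_ne hΨz
    filter_upwards [hne] with w hw
    rw [mul_div_cancel₀ _ hw]
  have hq : DifferentiableAt ℂ (fun w => Φ w / Ψ w) z := (hΦ.differentiableAt.div hΨ.differentiableAt hΨz)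
  rw [hev.deriv_eq, deriv_fun_mul hΨ.differentiableAt hq]
  simp only
  field_simp

/-- **Rouché's theorem on a rectangle** (`a < b`, `c < d`): if `Φ, Ψ` are analytic on a neighbourhood of
every point of the closed rectangle `[a,b] × [c,d]` and `‖Φ − Ψ‖ < ‖Ψ‖` on its boundary, then `Φ` and `Ψ` have
the same number of zeros in the open rectangle, counted with multiplicity (`meromorphicOrderAt`, as in the
tree's `Literature.Analysis.Complex.integral_boundary_rect_logDeriv`).  Proof: `Φ'/Φ = Ψ'/Ψ + h'/h` with
`h = Φ/Ψ` taking boundary values in the disc `|h − 1| < 1 ⊆` slit plane, whose boundary integral vanishes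
(`integral_boundary_rect_logDeriv_eq_zero_of_mem_slitPlane`). [cite: Conway1978, Ch. V §3 Thm 3.8 (Rouché)] -/
theorem finsum_order_eq_of_norm_sub_lt_rect {Φ Ψ : ℂ → ℂ} (hab : a < b) (hcd : c < d)
    (hΦ : AnalyticOnNhd ℂ Φ (Icc a b ×ℂ Icc c d)) (hΨ : AnalyticOnNhd ℂ Ψ (Icc a b ×ℂ Icc c d))
    (h_bot : ∀ x ∈ Icc a b, ‖Φ (x + c * I) - Ψ (x + c * I)‖ < ‖Ψ (x + c * I)‖)
    (h_top : ∀ x ∈ Icc a b, ‖Φ (x + d * I) - Ψ (x + d * I)‖ < ‖Ψ (x + d * I)‖)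
    (h_left : ∀ y ∈ Icc c d, ‖Φ (a + y * I) - Ψ (a + y * I)‖ < ‖Ψ (a + y * I)‖)
    (h_right : ∀ y ∈ Icc c d, ‖Φ (b + y * I) - Ψ (b + y * I)‖ < ‖Ψ (b + y * I)‖) :
    ∑ᶠ ρ ∈ {ρ : ℂ | Φ ρ = 0 ∧ ρ ∈ Ioo a b ×ℂ Ioo c d}, ((meromorphicOrderAt Φ ρ).untop₀ : ℂ) =
      ∑ᶠ ρ ∈ {ρ : ℂ | Ψ ρ = 0 ∧ ρ ∈ Ioo a b ×ℂ Ioo c d}, ((meromorphicOrderAt Ψ ρ).untop₀ : ℂ) := by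
  -- membership of boundary points in the closed rectangle
  have mem_h : ∀ {x y : ℝ}, x ∈ Icc a b → y ∈ Icc c d → ((x : ℂ) + y * I) ∈ Icc a b ×ℂ Icc c d := by
    intro x y hx hy
    refine ⟨by simpa using hx, by simpa using hy⟩
  set h : ℂ → ℂ := fun w => Φ w / Ψ w with hh
  -- pointwise facts at a boundary point
  have facts : ∀ {z : ℂ}, z ∈ Icc a b ×ℂ Icc c d → ‖Φ z - Ψ z‖ < ‖Ψ z‖ →
      Ψ z ≠ 0 ∧ Φ z ≠ 0 ∧ h z ∈ slitPlane ∧ AnalyticAt ℂ h z ∧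
        deriv Φ z / Φ z = deriv Ψ z / Ψ z + deriv h z / h z ∧
        ContinuousAt (fun w => deriv Ψ w / Ψ w) z ∧ ContinuousAt (fun w => deriv h w / h w) z := by
    intro z hz hlt
    obtain ⟨hΨz, hΦz, hsl⟩ := aux_of_norm_sub_lt hlt
    have hha : AnalyticAt ℂ h z := (hΦ z hz).div (hΨ z hz) hΨz
    have hhz : h z ≠ 0 := div_ne_zero hΦz hΨz
    refine ⟨hΨz, hΦz, hsl, hha, logDeriv_split (hΦ z hz) (hΨ z hz) hΨz hΦz, ?_, ?_⟩
    · exact ((hΨ z hz).deriv.continuousAt).div (hΨ z hz).continuousAt hΨz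
    · exact (hha.deriv.continuousAt).div hha.continuousAt hhz
  -- the argument principle for Φ and Ψ
  have hAΦ := Literature.Analysis.Complex.integral_boundary_rect_logDeriv hab hcd hΦ
    (fun x hx => (facts (mem_h hx ⟨le_rfl, hcd.le⟩) (h_bot x hx)).2.1)
    (fun x hx => (facts (mem_h hx ⟨hcd.le, le_rfl⟩) (h_top x hx)).2.1)
    (fun y hy => (facts (mem_h ⟨le_rfl, hab.le⟩ hy) (h_left y hy)).2.1)
    (fun y hy => (facts (mem_h ⟨hab.le, le_rfl⟩ hy) (h_right y hy)).2.1)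
  have hAΨ := Literature.Analysis.Complex.integral_boundary_rect_logDeriv hab hcd hΨ
    (fun x hx => (facts (mem_h hx ⟨le_rfl, hcd.le⟩) (h_bot x hx)).1)
    (fun x hx => (facts (mem_h hx ⟨hcd.le, le_rfl⟩) (h_top x hx)).1)
    (fun y hy => (facts (mem_h ⟨le_rfl, hab.le⟩ hy) (h_left y hy)).1)
    (fun y hy => (facts (mem_h ⟨hab.le, le_rfl⟩ hy) (h_right y hy)).1)
  -- the quotient has zero change of argument
  have hAh := Literature.Analysis.Complex.integral_boundary_rect_logDeriv_eq_zero_of_mem_slitPlane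
    (g := h) hab.le hcd.le
    (fun x hx => (facts (mem_h hx ⟨le_rfl, hcd.le⟩) (h_bot x hx)).2.2.2.1)
    (fun x hx => (facts (mem_h hx ⟨hcd.le, le_rfl⟩) (h_top x hx)).2.2.2.1)
    (fun y hy => (facts (mem_h ⟨le_rfl, hab.le⟩ hy) (h_left y hy)).2.2.2.1)
    (fun y hy => (facts (mem_h ⟨hab.le, le_rfl⟩ hy) (h_right y hy)).2.2.2.1)
    (fun x hx => (facts (mem_h hx ⟨le_rfl, hcd.le⟩) (h_bot x hx)).2.2.1)
    (fun x hx => (facts (mem_h hx ⟨hcd.le, le_rfl⟩) (h_top x hx)).2.2.1)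
    (fun y hy => (facts (mem_h ⟨le_rfl, hab.le⟩ hy) (h_left y hy)).2.2.1)
    (fun y hy => (facts (mem_h ⟨hab.le, le_rfl⟩ hy) (h_right y hy)).2.2.1)
  -- split Φ'/Φ on the boundary and add up
  have hsplit : Literature.Analysis.Complex.rectBoundaryIntegral (fun z => deriv Φ z / Φ z) a b c d =
      Literature.Analysis.Complex.rectBoundaryIntegral
        (fun z => deriv Ψ z / Ψ z + deriv h z / h z) a b c d :=
    Literature.Analysis.Complex.rectBoundaryIntegral_congr hab.le hcd.le
      (fun x hx => (facts (mem_h hx ⟨le_rfl, hcd.le⟩) (h_bot x hx)).2.2.2.2.1)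
      (fun x hx => (facts (mem_h hx ⟨hcd.le, le_rfl⟩) (h_top x hx)).2.2.2.2.1)
      (fun y hy => (facts (mem_h ⟨le_rfl, hab.le⟩ hy) (h_left y hy)).2.2.2.2.1)
      (fun y hy => (facts (mem_h ⟨hab.le, le_rfl⟩ hy) (h_right y hy)).2.2.2.2.1)
  have hadd := Literature.Analysis.Complex.rectBoundaryIntegral_add (F := fun z => deriv Ψ z / Ψ z)
    (G := fun z => deriv h z / h z) hab.le hcd.le
    (fun x hx => (facts (mem_h hx ⟨le_rfl, hcd.le⟩) (h_bot x hx)).2.2.2.2.2.1)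
    (fun x hx => (facts (mem_h hx ⟨hcd.le, le_rfl⟩) (h_top x hx)).2.2.2.2.2.1)
    (fun y hy => (facts (mem_h ⟨le_rfl, hab.le⟩ hy) (h_left y hy)).2.2.2.2.2.1)
    (fun y hy => (facts (mem_h ⟨hab.le, le_rfl⟩ hy) (h_right y hy)).2.2.2.2.2.1)
    (fun x hx => (facts (mem_h hx ⟨le_rfl, hcd.le⟩) (h_bot x hx)).2.2.2.2.2.2)
    (fun x hx => (facts (mem_h hx ⟨hcd.le, le_rfl⟩) (h_top x hx)).2.2.2.2.2.2)
    (fun y hy => (facts (mem_h ⟨le_rfl, hab.le⟩ hy) (h_left y hy)).2.2.2.2.2.2)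
    (fun y hy => (facts (mem_h ⟨hab.le, le_rfl⟩ hy) (h_right y hy)).2.2.2.2.2.2)
  have hAh' : Literature.Analysis.Complex.rectBoundaryIntegral (fun z => deriv h z / h z) a b c d = 0 := by
    rw [Literature.Analysis.Complex.rectBoundaryIntegral_def]; exact hAh
  have hAΦ' : Literature.Analysis.Complex.rectBoundaryIntegral (fun z => deriv Φ z / Φ z) a b c d =
      2 * Real.pi * I * ∑ᶠ ρ ∈ {ρ : ℂ | Φ ρ = 0 ∧ ρ ∈ Ioo a b ×ℂ Ioo c d},
        ((meromorphicOrderAt Φ ρ).untop₀ : ℂ) := by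
    rw [Literature.Analysis.Complex.rectBoundaryIntegral_def]; exact hAΦ
  have hAΨ' : Literature.Analysis.Complex.rectBoundaryIntegral (fun z => deriv Ψ z / Ψ z) a b c d =
      2 * Real.pi * I * ∑ᶠ ρ ∈ {ρ : ℂ | Ψ ρ = 0 ∧ ρ ∈ Ioo a b ×ℂ Ioo c d},
        ((meromorphicOrderAt Ψ ρ).untop₀ : ℂ) := by
    rw [Literature.Analysis.Complex.rectBoundaryIntegral_def]; exact hAΨ
  rw [hsplit, hadd, hAh', add_zero, hAΨ'] at hAΦ'
  have h2pi : (2 * Real.pi * I : ℂ) ≠ 0 := by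
    simp [Real.pi_ne_zero, I_ne_zero]
  exact (mul_right_injective₀ h2pi hAΦ').symm

end Rouche


end Summit.ValiantsHypothesis.ValiantsHypothesis.Theorems.LacunarySymmetroidMatrixDescartes.Separated
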